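import Summits.ResolutionOfSingularities.ResolutionOfSingularities.Theorems.EquisingularLiftEquisingularLiftNatPointTailEmbDim
import Summits.ResolutionOfSingularities.ResolutionOfSingularities.Theorems.EquisingularLiftEquisingularLiftNatMultisectionAdapterDim
import Summits.ResolutionOfSingularities.ResolutionOfSingularities.Theorems.EquisingularLiftEquisingularLiftNatHorizChainE1Sections
import HarnessLib

/-!
# [OURS · L1 W4.5(b) · EL♮] T-ISO-2 ASSEMBLY, `finrank`-of-the-cotangent-space spelling (sibling of
# Theorems/…NatSurfacePointResolvable): `horizChainE1_of_surfacePointResolvable_finrank`, with the missing ring brick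
# «the embedding dimension `dim_κ 𝔪/𝔪²` is invariant under ring isomorphisms of ARBITRARY local rings»

HONEST FRAMING. OURS (cell res-hironaka, rung L, slot W4.5(b), crux chain w45b; crux `EquisingularLiftNat` =
stmt-ResolutionOfSingularities-20038). NOT a statement of any manuscript; AI-written, kernel-checked, weaker than expert review.
Helper `--supports stmt-ResolutionOfSingularities-20038 --as helper`; closes nothing by itself. Prover: res-type-022 (g11);
res-L1-w45b-lead-2's OBJECT T-ISO-2 (2026-08-27T08:43:24Z) asked for the admissibility predicate in res-D-pv-013's spelling
`Adm Γ z :⟺ finrank_κ Cot(𝒪_{Γ,z}) ≤ n`; T-TAIL (`horizChainE1_of_pointResolvable`, p508794) needs `Adm` to be ISO-INVARIANT for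
ALL schemes, and the tree's `finrank_cotangentSpace_eq_of_ringEquiv` (…NatEmbDimDrop, B2) assumes a Noetherian ring. This file
supplies the hypothesis-free brick and the assembly:

* `finrank_cotangentSpace_eq_of_ringEquiv_of_isLocalRing` — for local rings `A ≃+* B` (no Noetherian hypothesis, any universes)
  `finrank_{κ(A)} 𝔪_A/𝔪_A² = finrank_{κ(B)} 𝔪_B/𝔪_B²`: the ring isomorphism induces an additive equivalence of cotangent spaces
  (`Ideal.mapCotangent` both ways) semilinear over `ResidueField.mapEquiv`, and `lift_rank_eq_of_equiv_equiv` transports the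
  rank (so also the junk value `0` of an infinite-dimensional cotangent space is respected);
* `finrank_cotangentSpace_stalk_le_of_iso` — the `hAdm` binder of T-TAIL for this predicate (scheme isomorphisms induce stalk
  isomorphisms);
* `horizChainE1_of_surfacePointResolvable_finrank` — T-TAIL from ANY horizontal-E1 stage with `Ch :=` the horizontal-E1 closure
  (inlined), `Adm := finrank ≤ n`, `hMS :=` res-L1-w45b-stub-2's `hMS_of_multisection_finrank_of_smoothOfRelativeDimension`
  (p514806; res-D-pv-003's adapter p513364 with T-DIM), over `q : P → Spec O` proper and smooth of relative dimension `n`.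

References: Matsumura, *Commutative Ring Theory*, Thms. 8.4, 14.2 [Matsumura1987] (through the cited tree files); Mathlib
`lift_rank_eq_of_equiv_equiv`, `Ideal.mapCotangent`, `IsLocalRing.ResidueField.mapEquiv`.
-/

set_option linter.dupNamespace false -- mandated namespace `Summit.<Summit>.<Problem>` of this single-conjunct summit
set_option linter.overlappingInstances false -- signatures carry `[IsDomain O] [IsDiscreteValuationRing O]`

noncomputable section

open CategoryTheory CategoryTheory.Limits AlgebraicGeometry TopologicalSpace Topology IsLocalRing
open Literature.AlgebraicGeometry.Resolution
open AlgebraicGeometry.Scheme.IdealSheafData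
open Summit.ResolutionOfSingularities.ResolutionOfSingularities.Theses.EquisingularLift.Split
open Summit.ResolutionOfSingularities.ResolutionOfSingularities.Cruxes.EquisingularLift.StrataSplit

namespace Summit.ResolutionOfSingularities.ResolutionOfSingularities.Cruxes.EquisingularLiftNat.Sections

universe u v

/-- **The embedding dimension `dim_κ 𝔪/𝔪²` is invariant under ring isomorphisms of arbitrary local rings** (no Noetherian
hypothesis; for an infinite-dimensional cotangent space both sides are the junk value `0`). [folklore] -/
theorem finrank_cotangentSpace_eq_of_ringEquiv_of_isLocalRing {A : Type u} {B : Type v} [CommRing A] [CommRing B]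
    [IsLocalRing A] [IsLocalRing B] (e : A ≃+* B) :
    Module.finrank (ResidueField A) (CotangentSpace A) = Module.finrank (ResidueField B) (CotangentSpace B) := by
  classical
  have hf : maximalIdeal A ≤ (maximalIdeal B).comap (e : A →+* B).toIntAlgHom := by
    intro x hx
    simp only [Ideal.mem_comap]
    show e x ∈ maximalIdeal B
    exact (map_mem_nonunits_iff (e : A →+* B) x).mpr hx
  have hg : maximalIdeal B ≤ (maximalIdeal A).comap (e.symm : B →+* A).toIntAlgHom := by
    intro x hx
    simp only [Ideal.mem_comap]
    show e.symm x ∈ maximalIdeal A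
    exact (map_mem_nonunits_iff (e.symm : B →+* A) x).mpr hx
  let jf := Ideal.mapCotangent (maximalIdeal A) (maximalIdeal B) (e : A →+* B).toIntAlgHom hf
  let jg := Ideal.mapCotangent (maximalIdeal B) (maximalIdeal A) (e.symm : B →+* A).toIntAlgHom hg
  have h1 : ∀ v, jg (jf v) = v := by
    intro v
    obtain ⟨x, rfl⟩ := Ideal.toCotangent_surjective _ v
    simp only [jf, jg, Ideal.mapCotangent_toCotangent]
    congr 1
    ext
    simp
  have h2 : ∀ w, jf (jg w) = w := by
    intro w
    obtain ⟨x, rfl⟩ := Ideal.toCotangent_surjective _ w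
    simp only [jf, jg, Ideal.mapCotangent_toCotangent]
    congr 1
    ext
    simp
  let j : CotangentSpace A ≃+ CotangentSpace B :=
    { toFun := jf, invFun := jg, left_inv := h1, right_inv := h2, map_add' := fun a b => map_add jf a b }
  have hc : ∀ (r : ResidueField A) (m : CotangentSpace A), j (r • m) = (ResidueField.mapEquiv e r) • j m := by
    intro r m
    obtain ⟨a, rfl⟩ := Ideal.Quotient.mk_surjective r
    obtain ⟨x, rfl⟩ := Ideal.toCotangent_surjective _ m
    have hr : (Ideal.Quotient.mk (maximalIdeal A) a : ResidueField A) = residue A a := rfl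
    rw [hr, ResidueField.mapEquiv_apply, ResidueField.map_residue]
    have hA : (residue A a) • (maximalIdeal A).toCotangent x = a • (maximalIdeal A).toCotangent x :=
      algebraMap_smul (ResidueField A) a _
    have hB : ∀ w : CotangentSpace B, (residue B ((e : A →+* B) a)) • w = ((e : A →+* B) a) • w :=
      fun w => algebraMap_smul (ResidueField B) _ w
    have hj : ∀ v, j v = jf v := fun v => rfl
    rw [hj, hj, hA, hB, ← map_smul ((maximalIdeal A).toCotangent)]
    simp only [jf, Ideal.mapCotangent_toCotangent]
    rw [← map_smul ((maximalIdeal B).toCotangent)]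
    congr 1
    ext
    simp [smul_eq_mul]
  have h := lift_rank_eq_of_equiv_equiv (ResidueField.mapEquiv e) j (ResidueField.mapEquiv e).bijective hc
  have := congr_arg Cardinal.toNat h
  simpa [Module.finrank, Cardinal.toNat_lift] using this

/-- **`hAdm` for `Adm Γ x :⟺ dim_κ 𝔪_{Γ,x}/𝔪_{Γ,x}² ≤ n`**: an isomorphism of schemes induces isomorphisms of stalks, and the
embedding dimension is invariant under ring isomorphisms — for ALL schemes. [folklore] -/
theorem finrank_cotangentSpace_stalk_le_of_iso (n : ℕ) (Γ Γ' : Scheme.{0}) (e : Γ ≅ Γ') (x : Γ)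
    (h : Module.finrank (ResidueField (Γ.presheaf.stalk x)) (CotangentSpace (Γ.presheaf.stalk x)) ≤ n) :
    Module.finrank (ResidueField (Γ'.presheaf.stalk (e.hom x))) (CotangentSpace (Γ'.presheaf.stalk (e.hom x))) ≤ n := by
  let f : Γ'.presheaf.stalk (e.hom x) ≃+* Γ.presheaf.stalk x := (asIso (e.hom.stalkMap x)).commRingCatIsoToRingEquiv
  rw [finrank_cotangentSpace_eq_of_ringEquiv_of_isLocalRing f]
  exact h

/-- **T-ISO-2, `finrank` spelling «SURFACE-POINT-RESOLVABLE ⇒ THE HORIZONTAL E1 CHAIN FINISHES».** As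
`horizChainE1_of_surfacePointResolvable` (sibling file) with the downstairs admissibility `dim_κ 𝔪_{Γ₁,x}/𝔪² ≤ n`
(res-D-pv-013's spelling) in place of `μ(𝔪_{Γ₁,x}) ≤ n`: res-D-pv-013's `horizChainE1_of_pointResolvable` ∘
`finrank_cotangentSpace_stalk_le_of_iso` ∘ res-L1-w45b-stub-2's `hMS_of_multisection_finrank_of_smoothOfRelativeDimension` ∘
`chain_of_horizChainE1`. [folklore packaging; cite: Matsumura1987, Thm. 8.4 and Thm. 14.2] -/
theorem horizChainE1_of_surfacePointResolvable_finrank (O : Type) [CommRing O] [IsDomain O] [IsDiscreteValuationRing O]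
    [IsAdicComplete (maximalIdeal O) O] [IsAlgClosed (ResidueField O)]
    (P : Scheme.{0}) [IsIntegral P] (q : P ⟶ Spec (.of O)) (Y : Closeds P) (n : ℕ) [SmoothOfRelativeDimension n q]
    (hqp : IsProper q) (hY : (Y : Set P) ⊆ q ⁻¹' {IsLocalRing.closedPoint O}) (hYirr : IsIrreducible (Y : Set P))
    (X₁ : Scheme.{0}) (σ₁ : X₁ ⟶ P) (S₁ : Set X₁)
    (hH : ∀ Q : (∀ X' : Scheme.{0}, (X' ⟶ P) → Set X' → Prop), Q P (𝟙 P) (Y : Set P) →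
      (∀ (X' X'' : Scheme.{0}) (σ' : X' ⟶ P) (Y' : Set X') (C : X'.IdealSheafData) (τ : X'' ⟶ X'),
        Q X' σ' Y' → IsBlowup τ C → Scheme.IsRegular C.subscheme → Flat (C.subschemeι ≫ σ' ≫ q) →
        σ' '' (C.support : Set X') ⊆ {x : P | ¬ IsGenericPoint x (Y : Set P)} →
        (C.support : Set X') ∩ (σ' ≫ q) ⁻¹' {IsLocalRing.closedPoint O} ⊆ Y' →
        Q X'' (τ ≫ σ') (closure (τ ⁻¹' (Y' \ (C.support : Set X'))))) →
      Q X₁ σ₁ S₁)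
    (Γ : Scheme.{0}) (e : Γ ≅ (vanishingIdeal (⟨closure S₁, isClosed_closure⟩ : Closeds X₁)).subscheme)
    (hres : ∃ Γs : Scheme.{0}, (∀ R : Scheme.{0} → Prop, R Γ →
      (∀ (Γ₁ Γ₂ : Scheme.{0}) (x : Γ₁) (hx : IsClosed ({x} : Set Γ₁)) (υ : Γ₂ ⟶ Γ₁), R Γ₁ →
        ¬ IsRegularLocalRing (Γ₁.presheaf.stalk x) →
        Module.finrank (ResidueField (Γ₁.presheaf.stalk x)) (CotangentSpace (Γ₁.presheaf.stalk x)) ≤ n →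
        IsBlowup υ (vanishingIdeal ⟨{x}, hx⟩) → R Γ₂) → R Γs) ∧
      Scheme.IsRegular Γs) :
    ∃ (X₂ : Scheme.{0}) (σ₂ : X₂ ⟶ P) (S₂ : Set X₂),
      (∀ Q : (∀ X' : Scheme.{0}, (X' ⟶ P) → Set X' → Prop), Q P (𝟙 P) (Y : Set P) →
        (∀ (X' X'' : Scheme.{0}) (σ' : X' ⟶ P) (Y' : Set X') (C : X'.IdealSheafData) (τ : X'' ⟶ X'),
          Q X' σ' Y' → IsBlowup τ C → Scheme.IsRegular C.subscheme → Flat (C.subschemeι ≫ σ' ≫ q) →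
          σ' '' (C.support : Set X') ⊆ {x : P | ¬ IsGenericPoint x (Y : Set P)} →
          (C.support : Set X') ∩ (σ' ≫ q) ⁻¹' {IsLocalRing.closedPoint O} ⊆ Y' →
          Q X'' (τ ≫ σ') (closure (τ ⁻¹' (Y' \ (C.support : Set X'))))) →
        Q X₂ σ₂ S₂) ∧
      Scheme.IsRegular (vanishingIdeal (⟨closure S₂, isClosed_closure⟩ : Closeds X₂)).subscheme :=
  horizChainE1_of_pointResolvable O P q Y
    (fun X' σ' S' => ∀ Q : (∀ X' : Scheme.{0}, (X' ⟶ P) → Set X' → Prop), Q P (𝟙 P) (Y : Set P) →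
      (∀ (X' X'' : Scheme.{0}) (σ' : X' ⟶ P) (Y' : Set X') (C : X'.IdealSheafData) (τ : X'' ⟶ X'),
        Q X' σ' Y' → IsBlowup τ C → Scheme.IsRegular C.subscheme → Flat (C.subschemeι ≫ σ' ≫ q) →
        σ' '' (C.support : Set X') ⊆ {x : P | ¬ IsGenericPoint x (Y : Set P)} →
        (C.support : Set X') ∩ (σ' ≫ q) ⁻¹' {IsLocalRing.closedPoint O} ⊆ Y' →
        Q X'' (τ ≫ σ') (closure (τ ⁻¹' (Y' \ (C.support : Set X'))))) →
      Q X' σ' S')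
    (fun _ σ S h => chain_of_horizChainE1 q (Y : Set P) σ S h)
    (fun X' X'' σ' S' C τ h hb hr hfl hg' hE Q h0 hs => hs X' X'' σ' S' C τ (h Q h0 hs) hb hr hfl hg' hE)
    (SmoothOfRelativeDimension.smooth n q) hqp hY hYirr
    (fun Γ₁ x => Module.finrank (ResidueField (Γ₁.presheaf.stalk x)) (CotangentSpace (Γ₁.presheaf.stalk x)) ≤ n)
    (finrank_cotangentSpace_stalk_le_of_iso n)
    (hMS_of_multisection_finrank_of_smoothOfRelativeDimension O P q Y _
      (fun _ σ S h => chain_of_horizChainE1 q (Y : Set P) σ S h) hY hYirr n)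
    X₁ σ₁ S₁ hH Γ e hres

end Summit.ResolutionOfSingularities.ResolutionOfSingularities.Cruxes.EquisingularLiftNat.Sections

end
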